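import Summits.CriticalPhenomena.CardyFormulaZ2.Theorems.CardyBoundaryCoulombGasHalfPlaneMarkDensityLawNoFreeConstant

/-!
# Lead's skeleton (c12-0), cycle 9: **FINITE-ARC SELF-DUALITY OF THE JOINT SUBSEQUENTIAL LIMITS**
# (crux `HalfPlaneMarkDensityLaw`, line `Sketch`; continuation of `Lines/Sketch_WiredDual.lean`)

For a joint subsequential limit `G` along a strictly increasing `θ` and `a < b < c`:
* T1 — the THREE-ARC limit `G₃(a,b,c) := lim_{y→∞} G(a,b,c,y)` exists (monotone in `y`) and equals the wired limit
  `W_G(c−b, b−a) = lim_M G(−M, −(c−b), 1/M, b−a)` of W1 (reflection `G(a,b,c,y) = G(−y,−c,−b,−a)`, translation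
  invariance, and the `δ`-move bound to straighten the third mark);
* T2 — with W2 (`W_G(σ,x) + W_G(x,σ) = 1`): **`G₃(a,b,c) + G₃(a, a+c−b, c) = 1`** — the three-arc crossing limits at a
  split point `b` of `[a,c]` and at the complementary split point `a+c−b` sum to one: the finite-arc self-duality of
  every subsequential scaling limit (Cardy: `F(u) + F(1−u) = 1`, `u = (b−a)/(c−a)`), unconditionally.
-/

noncomputable section

namespace Summit.CriticalPhenomena.CardyFormulaZ2.Cruxes.HalfPlaneMarkDensityLaw.SketchLine

open Literature.Probability.Percolation Literature.Probability.LatticeModels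
open MeasureTheory Filter Set
open scoped Topology
open Summit.CriticalPhenomena.CardyFormulaZ2.Theorems.HalfPlaneMarkDensityLaw.Negative

namespace WiredDual

/-- STUB T1: the three-arc limit exists and equals the wired limit `W_G(c−b, b−a)`. [folklore] -/
theorem stub_threeArc_limit :
    ∀ {θ : ℕ → ℕ} {G : ℝ → ℝ → ℝ → ℝ → ℝ},
      (∀ a b c y : ℝ, a < b → b < c → c < y →
        Tendsto (fun n ↦ μ.real (openCrossing halfPlane (arcA a b (θ n))
          (rowIcc ⌊c * (θ n : ℕ)⌋ ⌊y * (θ n : ℕ)⌋))) atTop (𝓝 (G a b c y))) →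
      StrictMono θ → ∀ a b c : ℝ, a < b → b < c → ∃ L : ℝ,
        Tendsto (fun y : ℝ ↦ G a b c y) atTop (𝓝 L) ∧
        Tendsto (fun M : ℕ ↦ G (-(M : ℝ)) (-(c - b)) ((M : ℝ)⁻¹) (b - a)) atTop (𝓝 L) := by
  sorry

/-- STUB T2: **`G₃(a,b,c) + G₃(a, a+c−b, c) = 1`.** [folklore] -/
theorem stub_threeArc_selfDual :
    ∀ {θ : ℕ → ℕ} {G : ℝ → ℝ → ℝ → ℝ → ℝ},
      (∀ a b c y : ℝ, a < b → b < c → c < y →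
        Tendsto (fun n ↦ μ.real (openCrossing halfPlane (arcA a b (θ n))
          (rowIcc ⌊c * (θ n : ℕ)⌋ ⌊y * (θ n : ℕ)⌋))) atTop (𝓝 (G a b c y))) →
      StrictMono θ → ∀ a b c : ℝ, a < b → b < c → ∀ L₁ L₂ : ℝ,
        Tendsto (fun y : ℝ ↦ G a b c y) atTop (𝓝 L₁) →
        Tendsto (fun y : ℝ ↦ G a (a + (c - b)) c y) atTop (𝓝 L₂) → L₁ + L₂ = 1 := by
  sorry

/-- STUB T1' (glue): W1 gives T1. [folklore] -/
theorem stub_threeArc_limit_of :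
    (∀ {θ : ℕ → ℕ} {G : ℝ → ℝ → ℝ → ℝ → ℝ}, (∀ a b c y : ℝ, a < b → b < c → c < y → Tendsto (fun n ↦ μ.real (openCrossing halfPlane (arcA a b (θ n)) (rowIcc ⌊c * (θ n : ℕ)⌋ ⌊y * (θ n : ℕ)⌋))) atTop (𝓝 (G a b c y))) → StrictMono θ → ∀ σ x : ℝ, 0 < σ → 0 < x → ∃ W : ℝ, Tendsto (fun M : ℕ ↦ G (-(M : ℝ)) (-σ) ((M : ℝ)⁻¹) x) atTop (𝓝 W) ∧ Tendsto (fun n ↦ μ.real (openCrossing halfPlane {v : Site 2 | v 1 = 0 ∧ v 0 ≤ -⌊σ * (θ n : ℕ)⌋} {v : Site 2 | v 1 = 0 ∧ 1 ≤ v 0 ∧ v 0 ≤ ⌊x * (θ n : ℕ)⌋})) atTop (𝓝 W)) →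
    ∀ {θ : ℕ → ℕ} {G : ℝ → ℝ → ℝ → ℝ → ℝ},
      (∀ a b c y : ℝ, a < b → b < c → c < y →
        Tendsto (fun n ↦ μ.real (openCrossing halfPlane (arcA a b (θ n))
          (rowIcc ⌊c * (θ n : ℕ)⌋ ⌊y * (θ n : ℕ)⌋))) atTop (𝓝 (G a b c y))) →
      StrictMono θ → ∀ a b c : ℝ, a < b → b < c → ∃ L : ℝ,
        Tendsto (fun y : ℝ ↦ G a b c y) atTop (𝓝 L) ∧
        Tendsto (fun M : ℕ ↦ G (-(M : ℝ)) (-(c - b)) ((M : ℝ)⁻¹) (b - a)) atTop (𝓝 L) := by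
  sorry

/-- STUB T2' (glue): T1 and W2 give T2. [folklore] -/
theorem stub_threeArc_selfDual_of :
    (∀ {θ : ℕ → ℕ} {G : ℝ → ℝ → ℝ → ℝ → ℝ},
      (∀ a b c y : ℝ, a < b → b < c → c < y →
        Tendsto (fun n ↦ μ.real (openCrossing halfPlane (arcA a b (θ n))
          (rowIcc ⌊c * (θ n : ℕ)⌋ ⌊y * (θ n : ℕ)⌋))) atTop (𝓝 (G a b c y))) →
      StrictMono θ → ∀ a b c : ℝ, a < b → b < c → ∃ L : ℝ,
        Tendsto (fun y : ℝ ↦ G a b c y) atTop (𝓝 L) ∧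
        Tendsto (fun M : ℕ ↦ G (-(M : ℝ)) (-(c - b)) ((M : ℝ)⁻¹) (b - a)) atTop (𝓝 L)) →
    (∀ {θ : ℕ → ℕ} {G : ℝ → ℝ → ℝ → ℝ → ℝ}, (∀ a b c y : ℝ, a < b → b < c → c < y → Tendsto (fun n ↦ μ.real (openCrossing halfPlane (arcA a b (θ n)) (rowIcc ⌊c * (θ n : ℕ)⌋ ⌊y * (θ n : ℕ)⌋))) atTop (𝓝 (G a b c y))) → StrictMono θ → ∀ σ x : ℝ, 0 < σ → 0 < x → ∀ W₁ W₂ : ℝ, Tendsto (fun M : ℕ ↦ G (-(M : ℝ)) (-σ) ((M : ℝ)⁻¹) x) atTop (𝓝 W₁) → Tendsto (fun M : ℕ ↦ G (-(M : ℝ)) (-x) ((M : ℝ)⁻¹) σ) atTop (𝓝 W₂) → W₁ + W₂ = 1) →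
    ∀ {θ : ℕ → ℕ} {G : ℝ → ℝ → ℝ → ℝ → ℝ},
      (∀ a b c y : ℝ, a < b → b < c → c < y →
        Tendsto (fun n ↦ μ.real (openCrossing halfPlane (arcA a b (θ n))
          (rowIcc ⌊c * (θ n : ℕ)⌋ ⌊y * (θ n : ℕ)⌋))) atTop (𝓝 (G a b c y))) →
      StrictMono θ → ∀ a b c : ℝ, a < b → b < c → ∀ L₁ L₂ : ℝ,
        Tendsto (fun y : ℝ ↦ G a b c y) atTop (𝓝 L₁) →
        Tendsto (fun y : ℝ ↦ G a (a + (c - b)) c y) atTop (𝓝 L₂) → L₁ + L₂ = 1 := by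
  sorry

end WiredDual

end Summit.CriticalPhenomena.CardyFormulaZ2.Cruxes.HalfPlaneMarkDensityLaw.SketchLine
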